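/-
Copyright (c) 2026. All rights reserved.
Released under Apache 2.0 license as described in the file LICENSE.
Authors: abc-iut cell, statement-typer seat abc-iut-L4-t3 (wave 1; gen 9), owner of the §5 interface.
-/
import Literature.AnabelianGeometry.AbsoluteAnabelian.Ltimes.LogFrobeniusCompatibility
import HarnessLib

/-!
# [AbsTopIII] Def 5.4 (vii): every carrier of the frozen §5 interface restricts to a `⋉`-carrier (`toLtimes`)

S. Mochizuki, *Topics in absolute anabelian geometry III*, J. Math. Sci. Univ. Tokyo 22 (2015) [MochizukiAbsTopIII2015];
manuscript `paper:url-5493eb38cbb7`, read on the page: Def 5.4 (vii) p. 128 l. 45–55, Cor 5.5 (iii) p. 131 l. 22–26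
(`ι⊞_{v,ε}` for the edges `ε` of `Γ⃗^⋉_v`, `ι_{v,ε}` for the edges of `Γ⃗^log_v`, at every place `v ∈ 𝕍(F_mod)`).

Sequel to `Ltimes/LogFrobeniusCompatibility.lean` (the `⋉`-successor interface `LogFrobeniusSettingLtimes`, cell typing finding T3g9-F1 / L4-lead m162):
* `LogFrobeniusSettingLtimes.toLtimes` — a carrier of the FROZEN interface `AbsoluteAnabelian.LogFrobeniusSetting` (with `ι⊞` along
  every archimedean arrow) IS a carrier of the successor: forget `ι⊞` along the space-link inclusion `k^× ↪ k`
  (`LogEdgeLtimes.toOld`), keep every other datum on the nose;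
* the field computation lemmas (`rfl`), `category_toLtimes` (`rfl` per vertex of `D•⊢`), `functor_toLtimes` (`HEq` per
  arrow), `iotaN_toLtimes`, `TSHomotopies_iota_toTS` — the pattern by which every theorem proved over the successor
  SPECIALISES to the frozen interface ("old theorems become `toLtimes` corollaries"), and by which the frozen carriers of
  record (`genuineOpen`, `archGenuineMonoAnChart`, the sums …) become `⋉`-carriers without being rebuilt.
A successor of OUR typing, print unchanged; refereed pre-IUT material; nothing here bears on [IUTchIII] Cor. 3.12; no side
taken; typed ≠ proved.
-/

set_option autoImplicit false

universe u

open CategoryTheory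

namespace Literature.AnabelianGeometry.AbsoluteAnabelian

namespace LogFrobeniusSetting

variable {Vmod : Type u} {isArc : Vmod → Bool}

/-! ## Every frozen-interface carrier restricts to a `⋉`-carrier -/

/-- **restriction `toLtimes`**: a carrier of the frozen interface (with `ι⊞` along every archimedean arrow) IS a carrier
of the successor — forget `ι⊞` along the space-link inclusion `k^× ↪ k`; every other datum is kept on the nose.  Theorems
proved over the successor therefore SPECIALISE to the frozen interface along this map.
[cite: MochizukiAbsTopIII2015, Def 5.4 (vii) p. 128] -/
def toLtimes (L : LogFrobeniusSetting Vmod isArc) : LogFrobeniusSettingLtimes Vmod isArc where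
  X := L.X
  E := L.E
  proj := L.proj
  log := L.log
  logIsoId := L.logIsoId
  logOver := L.logOver
  Nplus := L.Nplus
  N := L.N
  forget := L.forget
  toE := L.toE
  lam := L.lam
  lamOver := L.lamOver
  lam_spaceLink_eq_postLog := L.lam_spaceLink_eq_postLog
  iota v _ _ ε := L.iota v ε.toOld
  An := L.An
  κAn := L.κAn
  φAn := L.φAn
  φAn_isEquivalence := L.φAn_isEquivalence
  ηAn := L.ηAn
  κAn₂ := L.κAn₂
  Emono := L.Emono
  monoAn := L.monoAn
  NmonoPlus := L.NmonoPlus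
  Nmono := L.Nmono
  forgetMono := L.forgetMono
  toEmono := L.toEmono
  monoNplus := L.monoNplus
  monoN := L.monoN
  monoHomotopy := L.monoHomotopy
  AnMono := L.AnMono
  κAnMono := L.κAnMono
  ψAnMono := L.ψAnMono

variable (L : LogFrobeniusSetting Vmod isArc)

/-- `toLtimes` keeps `𝒳`. [cite: MochizukiAbsTopIII2015, Def 5.4 (i) p. 125] -/
@[simp] theorem toLtimes_X : L.toLtimes.X = L.X := rfl
/-- `toLtimes` keeps `ℰ•`. [cite: MochizukiAbsTopIII2015, Def 5.4 (i) p. 125] -/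
@[simp] theorem toLtimes_E : L.toLtimes.E = L.E := rfl
/-- `toLtimes` keeps `𝒳 → ℰ•`. [cite: MochizukiAbsTopIII2015, Def 5.4 (i) p. 125] -/
@[simp] theorem toLtimes_proj : L.toLtimes.proj = L.proj := rfl
/-- `toLtimes` keeps `log`. [cite: MochizukiAbsTopIII2015, Def 5.4 (ii) p. 125] -/
@[simp] theorem toLtimes_log : L.toLtimes.log = L.log := rfl
/-- `toLtimes` keeps `log ≅ id`. [cite: MochizukiAbsTopIII2015, Def 5.4 (ii) p. 125] -/
@[simp] theorem toLtimes_logIsoId : L.toLtimes.logIsoId = L.logIsoId := rfl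
/-- `toLtimes` keeps "`log` lies over `Th•`". [cite: MochizukiAbsTopIII2015, Def 5.4 (ii) p. 125] -/
@[simp] theorem toLtimes_logOver : L.toLtimes.logOver = L.logOver := rfl
/-- `toLtimes` keeps `𝒩⊞_v`. [cite: MochizukiAbsTopIII2015, Def 5.4 (iv) p. 127] -/
@[simp] theorem toLtimes_Nplus : L.toLtimes.Nplus = L.Nplus := rfl
/-- `toLtimes` keeps `𝒩_v`. [cite: MochizukiAbsTopIII2015, Def 5.4 (iv) p. 127] -/
@[simp] theorem toLtimes_N : L.toLtimes.N = L.N := rfl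
/-- `toLtimes` keeps `𝒩⊞_v → 𝒩_v`. [cite: MochizukiAbsTopIII2015, Def 5.4 (iv) p. 127] -/
@[simp] theorem toLtimes_forget : L.toLtimes.forget = L.forget := rfl
/-- `toLtimes` keeps `𝒩_v → ℰ•`. [cite: MochizukiAbsTopIII2015, Def 5.4 (iv) p. 127] -/
@[simp] theorem toLtimes_toE : L.toLtimes.toE = L.toE := rfl
/-- `toLtimes` keeps `λ⊞_{v,ν}`. [cite: MochizukiAbsTopIII2015, Def 5.4 (iv) p. 127] -/
@[simp] theorem toLtimes_lam : L.toLtimes.lam = L.lam := rfl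
/-- `toLtimes` keeps "`λ⊞` lies over `Th•`". [cite: MochizukiAbsTopIII2015, Def 5.4 (iv) p. 127] -/
@[simp] theorem toLtimes_lamOver : L.toLtimes.lamOver = L.lamOver := rfl
/-- `toLtimes` RESTRICTS `ι⊞` to the edges of `Γ⃗^⋉_v`. [cite: MochizukiAbsTopIII2015, Def 5.4 (vii) p. 128] -/
@[simp] theorem toLtimes_iota (v : Vmod) {ν₁ ν₂ : LogVertex (isArc v)} (ε : LogEdgeLtimes (isArc v) ν₁ ν₂) :
    L.toLtimes.iota v ε = L.iota v ε.toOld := rfl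
/-- `toLtimes` keeps `An•[𝒳]`. [cite: MochizukiAbsTopIII2015, Cor 5.5 p. 130] -/
@[simp] theorem toLtimes_An : L.toLtimes.An = L.An := rfl
/-- `toLtimes` keeps `κ_{An•}`. [cite: MochizukiAbsTopIII2015, Cor 5.5 p. 130] -/
@[simp] theorem toLtimes_κAn : L.toLtimes.κAn = L.κAn := rfl
/-- `toLtimes` keeps `φ_{An•}`. [cite: MochizukiAbsTopIII2015, Cor 5.5 p. 130] -/
@[simp] theorem toLtimes_φAn : L.toLtimes.φAn = L.φAn := rfl
/-- `toLtimes` keeps `η_{An•}`. [cite: MochizukiAbsTopIII2015, Cor 5.5 p. 130] -/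
@[simp] theorem toLtimes_ηAn : L.toLtimes.ηAn = L.ηAn := rfl
/-- `toLtimes` keeps the second equivalence `An•[𝒳] ≃ ℰ•`. [cite: MochizukiAbsTopIII2015, Cor 5.5 p. 130] -/
@[simp] theorem toLtimes_κAn₂ : L.toLtimes.κAn₂ = L.κAn₂ := rfl
/-- `toLtimes` keeps `ℰ⊢`. [cite: MochizukiAbsTopIII2015, Def 5.6 (ii) p. 135] -/
@[simp] theorem toLtimes_Emono : L.toLtimes.Emono = L.Emono := rfl
/-- `toLtimes` keeps `ℰ• → ℰ⊢`. [cite: MochizukiAbsTopIII2015, Def 5.6 (ii) p. 135] -/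
@[simp] theorem toLtimes_monoAn : L.toLtimes.monoAn = L.monoAn := rfl
/-- `toLtimes` keeps `𝒩⊢⊞_w`. [cite: MochizukiAbsTopIII2015, Def 5.6 (iii) p. 136] -/
@[simp] theorem toLtimes_NmonoPlus : L.toLtimes.NmonoPlus = L.NmonoPlus := rfl
/-- `toLtimes` keeps `𝒩⊢_w`. [cite: MochizukiAbsTopIII2015, Def 5.6 (iii) p. 136] -/
@[simp] theorem toLtimes_Nmono : L.toLtimes.Nmono = L.Nmono := rfl
/-- `toLtimes` keeps `𝒩⊢⊞_w → 𝒩⊢_w`. [cite: MochizukiAbsTopIII2015, Def 5.6 (iii) p. 136] -/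
@[simp] theorem toLtimes_forgetMono : L.toLtimes.forgetMono = L.forgetMono := rfl
/-- `toLtimes` keeps `𝒩⊢_w → ℰ⊢`. [cite: MochizukiAbsTopIII2015, Def 5.6 (iii) p. 136] -/
@[simp] theorem toLtimes_toEmono : L.toLtimes.toEmono = L.toEmono := rfl
/-- `toLtimes` keeps `𝒩⊞_v → 𝒩⊢⊞_v`. [cite: MochizukiAbsTopIII2015, Def 5.6 (iv) p. 136] -/
@[simp] theorem toLtimes_monoNplus : L.toLtimes.monoNplus = L.monoNplus := rfl
/-- `toLtimes` keeps `𝒩_v → 𝒩⊢_v`. [cite: MochizukiAbsTopIII2015, Def 5.6 (iv) p. 136] -/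
@[simp] theorem toLtimes_monoN : L.toLtimes.monoN = L.monoN := rfl
/-- `toLtimes` keeps the mono-analyticization homotopy of rows 3 → 4. [cite: MochizukiAbsTopIII2015, Def 5.6 (iv) p. 136] -/
@[simp] theorem toLtimes_monoHomotopy : L.toLtimes.monoHomotopy = L.monoHomotopy := rfl
/-- `toLtimes` keeps `An⊢[𝒩⊢⊞]`. [cite: MochizukiAbsTopIII2015, Prop 5.8 (vii) p. 141] -/
@[simp] theorem toLtimes_AnMono : L.toLtimes.AnMono = L.AnMono := rfl
/-- `toLtimes` keeps `ℰ⊢ ≌ An⊢[𝒩⊢⊞]`. [cite: MochizukiAbsTopIII2015, Prop 5.8 (vii) p. 141] -/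
@[simp] theorem toLtimes_κAnMono : L.toLtimes.κAnMono = L.κAnMono := rfl
/-- `toLtimes` keeps `ψ^{An⊢⊞}_{w,ν}`. [cite: MochizukiAbsTopIII2015, Prop 5.8 (vii) p. 141] -/
@[simp] theorem toLtimes_ψAnMono : L.toLtimes.ψAnMono = L.ψAnMono := rfl

/-- the realised category at every vertex of `D•⊢` is unchanged by `toLtimes`. [cite: MochizukiAbsTopIII2015, Cor 5.5 p. 129] -/
theorem category_toLtimes (x : DVertex Vmod isArc) :
    x.categoryLtimes L.toLtimes = x.category L := by
  cases x <;> rfl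

/-- the realised functor at every arrow of `D•⊢` is unchanged by `toLtimes` (heterogeneously, along `category_toLtimes`).
[cite: MochizukiAbsTopIII2015, Cor 5.5 p. 129] -/
theorem functor_toLtimes {a b : DVertex Vmod isArc} (e : DEdge isArc a b) :
    HEq (DEdge.functorLtimes L.toLtimes e) (DEdge.functor L e) := by
  cases e <;> rfl

/-- the `TS`-valued homotopy of `toLtimes L` along an edge of `Γ⃗^⋉_v` is the frozen `ι⊞` pushed down to `𝒩_v` — so a
`TSHomotopies` datum of `L` restricts along `LogEdgeLtimes.toOld` (`iota_toTS`). [cite: MochizukiAbsTopIII2015, Def 5.4 (vii) p. 128] -/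
theorem iotaN_toLtimes (v : Vmod) {ν₁ ν₂ : LogVertex (isArc v)} (ε : LogEdgeLtimes (isArc v) ν₁ ν₂) :
    L.toLtimes.iotaN v ε = Functor.whiskerRight (L.iota v ε.toOld) (L.forget v) := rfl

/-- … and agrees with any `TS`-homotopy datum of the frozen carrier on those edges. [cite: MochizukiAbsTopIII2015, Def 5.4 (vii) p. 128] -/
theorem TSHomotopies_iota_toTS (T : L.TSHomotopies) (v : Vmod) {ν₁ ν₂ : LogVertex (isArc v)}
    (ε : LogEdgeLtimes (isArc v) ν₁ ν₂) : T.iota v ε.toTS = L.toLtimes.iotaN v ε := by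
  rw [← LogEdgeLtimes.toOld_toTS, T.iota_toTS]
  rfl

end LogFrobeniusSetting

end Literature.AnabelianGeometry.AbsoluteAnabelian
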